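import Summits.AtomisticToContinuum.FouriersLaw.Theorems.BondHeatUncertaintySubdiffusiveBondHeatJunctionRatioPeelingDepthOne

/-!
# `JunctionRatioRootContact` — file 18a: ROOT CONTACT LAWS (grade ½ of the contact share) and the ROOT-SLACK SEAM of the peeled door
# (cell `decomp-a2c`, lens-1 «grading / quantitative ladder», gen 62, re-emitted gen 63 as two files ≤ 400 lines: 18a = §A–§C here,
# 18b = `…JunctionRatioRootContactFrames` = §D absorption + §E global laws and frames; beneath the door of record
# `(∀ ρ < 1, RelativeLocalityLaw ρ) ∧ EscapeInfZero ⟹ AsymptoticSeriesLaw` of files 15a/16 and its contact peeling, files 17a/17b; target 11071)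
Files 17a/17b peel the contact region of depth `d + 1` off the door's profile clause and expose two LOCAL laws next to the thermostat:
`ContactPositivityAt … d` [NFO_d] (the first-order drop bath ↦ site `d` is `≥ −εδ`) and `ContactShareAt … C d` [CS_d] (it is `≤ δ·(C·E_N + ε)`),
both THEOREMS at `d = 0` and IDEA-NEEDED at `d ≥ 1`.  This file grades the contact laws along the ORDER axis of the slack in the contact-drop
unit `E_N·δ = j/γ + o(δ)`: exponent `1` (files 17a/17b) versus exponent `½` (this file):

* `RootPositivityAt … C d` [RP_d] — ROOT POSITIVITY at depth `d + 1`: `(T + δ/2) − ⟨p_d²⟩ ≥ −δ·(C·√E_N + ε)` and the mirror clause at the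
  cold end: to first order in `δ` no site of the contact region is hotter than the hot bath BY MORE THAN `C·√E_N` contact-drop units.  WEAKER
  than [NFO_d] (`rootPositivityAt_of_contactPositivityAt`, every `C ≥ 0`); `d = 0` PROVED (`rootPositivityAt_zero`).  Idea class at `d ≥ 1`: NOT a
  maximum principle — LINEAR HYPOELLIPTIC TRANSFER of the boundary entropy production: with `h` the first-order response density,
  `w := h − (H/(2T²) − c)`, `g₀ := ∂_{p₀} w` and the cold-end mirror `g_{N−1} := ∂_{p_{N−1}}(h + H/(2T²))`, the entropy-production identity gives
  `‖g₀‖²_{L²(μ₀)} + ‖g_{N−1}‖² = E_N/T³` EXACTLY (boundary Fisher information is CURRENT currency), and the commutator identities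
  `∂_{q₀} w = (L† − γ) g₀`, `V″(r₀)·∂_{p₁} w = L† ∂_{q₀} w + (U″(q₀) + V″(r₀))·g₀` (`L† = −A + γS` = the `L²(μ₀)`-adjoint, `N ≥ 3`) transfer it
  one bond inward: `⟨ψ·V″(r₀), ∂_{p₁} w⟩₀ = ⟨Ψ[ψ], g₀⟩₀` with `Ψ[ψ] := (L − γ)Lψ + (U″(q₀) + V″(r₀))·ψ`, every local test function `ψ`; with
  `ψ := p₁/V″(r₀)` (`V″ = 1 + 3βr² ≥ 1`) and Cauchy–Schwarz the first-order drop fraction `φ₁ := ((T + δ/2) − ⟨p₁²⟩)/δ` obeys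
  `|φ₁| = T·|⟨Ψ, g₀⟩₀| ≤ ‖Ψ‖_{L²(μ₀)}·√(E_N/T)` with an N-UNIFORM local Gibbs norm (log-concave `μ₀`) — the two-sided law
  `RootThermalisationAt … C 1` below; by the recursion `∂_{q_{d−1}} w = L† ∂_{p_{d−1}} w` the same holds at every fixed depth.  HARMONIC CHECK
  (exact Gaussian algebra, `decomp-a2c-lens-1/g62/calib/bracket_check.py`, pure python, nine parameter sets, `N ≤ 8`): the entropy-production
  identity and the depth-1 bracket identity `φ₁ = −T⟨Ψ, g₀⟩₀`, `Ψ = p₀ − p₁ + p₂ − (γ/V″)·F₁(q)`, hold to `10⁻¹²`; the root bound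
  `|φ₁| ≤ ‖Ψ‖·√(E/T)` holds with ratio `0.42–0.70`.  Tags: `d ≥ 1` UNDECIDED · ATTACKABLE (mechanism in hand; Lean needs the entropy-production
  inequality of the steady state as a cited fact and first-order bookkeeping at fixed `N`) · INSTRUMENTABLE · harmonic-TRUE.  [piece · root positivity]
* `RootThermalisationAt … C d` [RT_d] — the two-sided sibling `|(T + δ/2) − ⟨p_d²⟩| ≤ δ·(C·√E_N + ε)` (and mirror): the GRADE-½ CONTACT SHARE.
  It is what the transfer mechanism proves; it implies [RP_d] (`rootPositivityAt_of_rootThermalisationAt`) and is implied by [NFO_d] ∧ [CS_d]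
  (`rootThermalisationAt_of_contactLaws`, since `E_N ≤ √E_N`); `d = 0` PROVED with `C = 1`.  It does NOT replace [CS_d] in the converse frame
  of file 17a (`peeled_of_relativeBlockLawAt` needs exponent `1`: a slack `C·√E_N·δ` is not small against the block drop `ρ·E_N/E_u·δ` for
  `N ≫ u²` unless `E_n` has a floor).  [attack target · grade-½ share]
* `RatioJunctionRootAt … ρ b c L₀` — the mixed ratio–junction inequality of file 15a WITH A ROOT SLACK: `ρ·(1/E_u + 1/E_v) − b − c/√E_N ≤ 1/E_N`,
  `N = u + L₀ + v`.  [piece · per-temperature]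

Seam (PROVED, five first-order drops telescope to `δ` at one small `δ` and one steady state):
`ratioJunctionRootAt_of_rootPeeled : RP_d(C) ∧ PBL(ρ, d, L₀) ∧ BufferPassivityAt(b, L₀) ⟹ RatioJunctionRootAt ρ b (2C) L₀`.
Absorption (PROVED): in RESISTANCE currency `r_n = 1/E_n` the root slack reads `c·√r_N` and is eaten by the one-good-scale mechanism of file 15a —
`escapeSmall_of_ratioJunctionRootAt` (one scale `u⋆` with `E_{u⋆}` small propagates through the root inequality to `E_n ≤ η` for ALL large `n`:
`liminf = 0 ⟹ lim = 0` under any positive root rung) and `ratioJunctionAt_of_root : RatioJunctionRootAt ρ b c ∧ (liminf_n E_n = 0) ⟹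
RatioJunctionAt ρ' (max b 0)` for every `ρ' < ρ`; then file 15a's `ratioJunctionAt_absorb` removes the budget.
Frames by name: `seriesRatioLaw_of_rootPeeled_of_escapeInfZero`, `asymptoticSeriesLaw_of_rootPeeled_of_escapeInfZero`
(`(∀ ρ < 1, PeeledLocalityLaw ρ d) ∧ RootPositivity d ∧ EscapeInfZero ⟹ AsymptoticSeriesLaw`),
Absorption, global laws and the frames by name (`escapeSmall_of_ratioJunctionRootAt`, `ratioJunctionAt_of_root`, `RootPositivity`,
`RootThermalisation`, `asymptoticSeriesLaw_of_rootPeeled_of_escapeInfZero`, `boundedResponse_of_rootPeeled_of_escapeInfZero_of_subOhmicBootstrap`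
= 11071 BY NAME, `escapeVanishing_of_rootPeeled_of_escapeInfZero`) are file 18b.
No `sorry`; standard axioms; imports only file 17b (tree).
-/

noncomputable section

open MeasureTheory Filter Topology Set
open scoped BigOperators

namespace Summit.AtomisticToContinuum.FouriersLaw.Theorems.SubdiffusiveBondHeat

namespace EscapeGrading

open Literature.MathematicalPhysics.KineticTheory.HeatConduction
open Summit.AtomisticToContinuum.FouriersLaw.Theses.BondHeatUncertainty (BoundedResponse NonBallistic)
open Summit.AtomisticToContinuum.FouriersLaw.Theorems.SubdiffusiveBondHeat.JunctionDefectGrading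

/-! ## A. Root contact laws at depth `d + 1` and the root junction inequality (fixed parameters and temperature) -/

/-- **Root positivity at depth `d + 1`** [RP_d] with constant `C` at `(ω₂, lam, β, γ, T)`: `∃ N₂, ∀ N ≥ N₂` (`N ≥ d + 1`), `∀ ε > 0`, for all small
`δ > 0` and every steady state `μ` of the `N`-chain at `(T + δ/2, T − δ/2)`: `(T + δ/2) − ⟨p_d²⟩_μ ≥ −δ·(C·√E_N + ε)` and
`⟨p_{N−1−d}²⟩_μ − (T − δ/2) ≥ −δ·(C·√E_N + ε)` (`E_N = escapeDeficit … T N`).  Tags: WEAKER than `ContactPositivityAt … d` (every `C ≥ 0`);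
`d = 0` PROVED; `d ≥ 1` UNDECIDED · ATTACKABLE (linear hypoelliptic transfer of the boundary entropy production, file docstring) · INSTRUMENTABLE ·
harmonic-TRUE. [piece · root positivity] -/
def RootPositivityAt (ω₂ lam β γ T C : ℝ) (d : ℕ) : Prop :=
  ∃ N₂ : ℕ, ∀ N : ℕ, N₂ ≤ N → ∀ (_hN : d + 1 ≤ N), ∀ ε : ℝ, 0 < ε →
    ∃ δ₀ : ℝ, 0 < δ₀ ∧ ∀ δ : ℝ, 0 < δ → δ < δ₀ →
      ∀ μ : Measure (PhaseSpace N), (pinnedChain ω₂ lam β γ).IsSteadyState N (T + δ / 2) (T - δ / 2) μ →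
        -(δ * (C * Real.sqrt (escapeDeficit ω₂ lam β γ T N) + ε)) ≤ (T + δ / 2) - ∫ x, x.2 ⟨d, by omega⟩ ^ 2 ∂μ ∧
        -(δ * (C * Real.sqrt (escapeDeficit ω₂ lam β γ T N) + ε)) ≤ ∫ x, x.2 ⟨N - 1 - d, by omega⟩ ^ 2 ∂μ - (T - δ / 2)

/-- **Root thermalisation at depth `d + 1`** [RT_d] with constant `C`: same quantifiers, TWO-SIDED: `|(T + δ/2) − ⟨p_d²⟩_μ| ≤ δ·(C·√E_N + ε)` and
`|⟨p_{N−1−d}²⟩_μ − (T − δ/2)| ≤ δ·(C·√E_N + ε)` — the grade-½ contact share.  Tags: implied by `ContactPositivityAt ∧ ContactShareAt … C`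
(`C ≥ 0`); implies `RootPositivityAt … C`; `d = 0` PROVED (`C = 1`); `d ≥ 1` UNDECIDED · ATTACKABLE (the transfer mechanism proves exactly this)
· INSTRUMENTABLE · harmonic-TRUE; NOT a substitute for `ContactShareAt` in file 17a's converse frame. [attack target · grade-½ share] -/
def RootThermalisationAt (ω₂ lam β γ T C : ℝ) (d : ℕ) : Prop :=
  ∃ N₂ : ℕ, ∀ N : ℕ, N₂ ≤ N → ∀ (_hN : d + 1 ≤ N), ∀ ε : ℝ, 0 < ε →
    ∃ δ₀ : ℝ, 0 < δ₀ ∧ ∀ δ : ℝ, 0 < δ → δ < δ₀ →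
      ∀ μ : Measure (PhaseSpace N), (pinnedChain ω₂ lam β γ).IsSteadyState N (T + δ / 2) (T - δ / 2) μ →
        |(T + δ / 2) - ∫ x, x.2 ⟨d, by omega⟩ ^ 2 ∂μ| ≤ δ * (C * Real.sqrt (escapeDeficit ω₂ lam β γ T N) + ε) ∧
        |∫ x, x.2 ⟨N - 1 - d, by omega⟩ ^ 2 ∂μ - (T - δ / 2)| ≤ δ * (C * Real.sqrt (escapeDeficit ω₂ lam β γ T N) + ε)

/-- **The mixed ratio–junction inequality with a root slack** at `(ω₂, lam, β, γ, T)`: `∃ N₂, ∀ u v ≥ N₂,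
ρ·(1/E_u + 1/E_v) − b − c/√E_{u+L₀+v} ≤ 1/E_{u+L₀+v}`.  `c = 0` is file 15a's `RatioJunctionAt … ρ b L₀`; in resistance currency the new slack
is `c·√r_N`, sublinear in `r_N`, hence absorbable (`ratioJunctionAt_of_root`). [piece · per-temperature] -/
def RatioJunctionRootAt (ω₂ lam β γ T ρ b c : ℝ) (L₀ : ℕ) : Prop :=
  ∃ N₂ : ℕ, ∀ u v : ℕ, N₂ ≤ u → N₂ ≤ v →
    ρ * (1 / escapeDeficit ω₂ lam β γ T u + 1 / escapeDeficit ω₂ lam β γ T v) - b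
        - c / Real.sqrt (escapeDeficit ω₂ lam β γ T (u + L₀ + v))
      ≤ 1 / escapeDeficit ω₂ lam β γ T (u + L₀ + v)

/-! ## B. Order comparisons and the depth-one floor -/

/-- `E_N ≤ √E_N` (`0 ≤ E_N ≤ 1`, tree theorems `escapeDeficit_pos`, `escapeDeficit_le_one`). [folklore] -/
theorem escapeDeficit_le_sqrt {ω₂ lam β γ T : ℝ} (hω : 0 < ω₂) (hl : 0 < lam) (hβ : 0 < β) (hγ : 0 < γ) (hT : 0 < T)
    {N : ℕ} (hN : 2 ≤ N) : escapeDeficit ω₂ lam β γ T N ≤ Real.sqrt (escapeDeficit ω₂ lam β γ T N) := by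
  have h0 : 0 ≤ escapeDeficit ω₂ lam β γ T N := (escapeDeficit_pos hω hl hβ hγ hT hN).le
  have h1 : escapeDeficit ω₂ lam β γ T N ≤ 1 := escapeDeficit_le_one ω₂ lam β γ hω hl hβ hγ T hT N
  have hs1 : Real.sqrt (escapeDeficit ω₂ lam β γ T N) ≤ 1 := Real.sqrt_le_one.2 h1
  have hs0 : 0 ≤ Real.sqrt (escapeDeficit ω₂ lam β γ T N) := Real.sqrt_nonneg _
  calc escapeDeficit ω₂ lam β γ T N
      = Real.sqrt (escapeDeficit ω₂ lam β γ T N) * Real.sqrt (escapeDeficit ω₂ lam β γ T N) := (Real.mul_self_sqrt h0).symm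
    _ ≤ Real.sqrt (escapeDeficit ω₂ lam β γ T N) * 1 := mul_le_mul_of_nonneg_left hs1 hs0
    _ = Real.sqrt (escapeDeficit ω₂ lam β γ T N) := mul_one _

/-- **`NFO_d ⟹ RP_d(C)` for every `C ≥ 0`** — exact positivity is the case `C = 0` of root positivity. [folklore] -/
theorem rootPositivityAt_of_contactPositivityAt {ω₂ lam β γ T C : ℝ} {d : ℕ} (hC : 0 ≤ C)
    (h : ContactPositivityAt ω₂ lam β γ T d) : RootPositivityAt ω₂ lam β γ T C d := by
  obtain ⟨N₂, h⟩ := h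
  refine ⟨N₂, fun N hN hNd ε hε => ?_⟩
  obtain ⟨δ₀, hδ₀, h'⟩ := h N hN hNd ε hε
  refine ⟨δ₀, hδ₀, fun δ hδ hδlt μ hμ => ?_⟩
  obtain ⟨hle, hri⟩ := h' δ hδ hδlt μ hμ
  have h0 : 0 ≤ δ * (C * Real.sqrt (escapeDeficit ω₂ lam β γ T N)) :=
    mul_nonneg hδ.le (mul_nonneg hC (Real.sqrt_nonneg _))
  have e : -(δ * (C * Real.sqrt (escapeDeficit ω₂ lam β γ T N) + ε))
      = -(δ * ε) - δ * (C * Real.sqrt (escapeDeficit ω₂ lam β γ T N)) := by ring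
  rw [e]
  exact ⟨by linarith, by linarith⟩

/-- **`RT_d(C) ⟹ RP_d(C)`** (lower halves). [folklore] -/
theorem rootPositivityAt_of_rootThermalisationAt {ω₂ lam β γ T C : ℝ} {d : ℕ}
    (h : RootThermalisationAt ω₂ lam β γ T C d) : RootPositivityAt ω₂ lam β γ T C d := by
  obtain ⟨N₂, h⟩ := h
  refine ⟨N₂, fun N hN hNd ε hε => ?_⟩
  obtain ⟨δ₀, hδ₀, h'⟩ := h N hN hNd ε hε
  refine ⟨δ₀, hδ₀, fun δ hδ hδlt μ hμ => ?_⟩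
  obtain ⟨hle, hri⟩ := h' δ hδ hδlt μ hμ
  exact ⟨by linarith [(abs_le.1 hle).1], by linarith [(abs_le.1 hri).1]⟩

/-- **`NFO_d ∧ CS_d(C) ⟹ RT_d(C)`** (`C ≥ 0`; `C·E_N ≤ C·√E_N`): the exact contact laws of file 17a imply the root laws. [folklore] -/
theorem rootThermalisationAt_of_contactLaws {ω₂ lam β γ T C : ℝ} {d : ℕ} (hω : 0 < ω₂) (hl : 0 < lam) (hβ : 0 < β)
    (hγ : 0 < γ) (hT : 0 < T) (hC : 0 ≤ C) (hP : ContactPositivityAt ω₂ lam β γ T d) (hS : ContactShareAt ω₂ lam β γ T C d) :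
    RootThermalisationAt ω₂ lam β γ T C d := by
  obtain ⟨N₂, hP⟩ := hP
  obtain ⟨N₂', hS⟩ := hS
  refine ⟨max (max N₂ N₂') 2, fun N hN hNd ε hε => ?_⟩
  have hN2 : 2 ≤ N := le_trans (le_max_right _ _) hN
  obtain ⟨δ₁, hδ₁, h1⟩ := hP N (le_trans (le_trans (le_max_left _ _) (le_max_left _ _)) hN) hNd ε hε
  obtain ⟨δ₂, hδ₂, h2⟩ := hS N (le_trans (le_trans (le_max_right _ _) (le_max_left _ _)) hN) hNd ε hε
  refine ⟨min δ₁ δ₂, lt_min hδ₁ hδ₂, fun δ hδ hδlt μ hμ => ?_⟩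
  obtain ⟨hl1, hr1⟩ := h1 δ hδ (lt_of_lt_of_le hδlt (min_le_left _ _)) μ hμ
  obtain ⟨hl2, hr2⟩ := h2 δ hδ (lt_of_lt_of_le hδlt (min_le_right _ _)) μ hμ
  have hE := escapeDeficit_le_sqrt hω hl hβ hγ hT hN2
  have hCE : δ * (C * escapeDeficit ω₂ lam β γ T N + ε) ≤ δ * (C * Real.sqrt (escapeDeficit ω₂ lam β γ T N) + ε) :=
    mul_le_mul_of_nonneg_left (by linarith [mul_le_mul_of_nonneg_left hE hC]) hδ.le
  have h0 : 0 ≤ δ * (C * Real.sqrt (escapeDeficit ω₂ lam β γ T N)) :=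
    mul_nonneg hδ.le (mul_nonneg hC (Real.sqrt_nonneg _))
  have e : δ * (C * Real.sqrt (escapeDeficit ω₂ lam β γ T N) + ε) = δ * (C * Real.sqrt (escapeDeficit ω₂ lam β γ T N)) + δ * ε := by
    ring
  constructor
  · rw [abs_le]; constructor <;> linarith
  · rw [abs_le]; constructor <;> linarith

/-- Larger constant = WEAKER root law. [folklore] -/
theorem rootPositivityAt_mono {ω₂ lam β γ T C C' : ℝ} {d : ℕ} (hCC' : C ≤ C')
    (h : RootPositivityAt ω₂ lam β γ T C d) : RootPositivityAt ω₂ lam β γ T C' d := by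
  obtain ⟨N₂, h⟩ := h
  refine ⟨N₂, fun N hN hNd ε hε => ?_⟩
  obtain ⟨δ₀, hδ₀, h'⟩ := h N hN hNd ε hε
  refine ⟨δ₀, hδ₀, fun δ hδ hδlt μ hμ => ?_⟩
  obtain ⟨hle, hri⟩ := h' δ hδ hδlt μ hμ
  have hm : δ * (C * Real.sqrt (escapeDeficit ω₂ lam β γ T N) + ε) ≤ δ * (C' * Real.sqrt (escapeDeficit ω₂ lam β γ T N) + ε) :=
    mul_le_mul_of_nonneg_left (by nlinarith [Real.sqrt_nonneg (escapeDeficit ω₂ lam β γ T N)]) hδ.le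
  exact ⟨by linarith, by linarith⟩

/-- **Depth one (`d = 0`): `RootThermalisationAt … 1 0`** — from file 17b's exact contact laws `contactPositivityAt_zero`, `contactShareAt_one_zero`.
[this file] -/
theorem rootThermalisationAt_one_zero {ω₂ lam β γ T : ℝ} (hω : 0 < ω₂) (hl : 0 < lam) (hβ : 0 < β) (hγ : 0 < γ) (hT : 0 < T) :
    RootThermalisationAt ω₂ lam β γ T 1 0 :=
  rootThermalisationAt_of_contactLaws hω hl hβ hγ hT zero_le_one (contactPositivityAt_zero hω hl hβ hγ hT)
    (contactShareAt_one_zero hω hl hβ hγ hT)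

/-- **Depth one: `RootPositivityAt … C 0` for every `C ≥ 0`.** [this file] -/
theorem rootPositivityAt_zero {ω₂ lam β γ T C : ℝ} (hω : 0 < ω₂) (hl : 0 < lam) (hβ : 0 < β) (hγ : 0 < γ) (hT : 0 < T)
    (hC : 0 ≤ C) : RootPositivityAt ω₂ lam β γ T C 0 :=
  rootPositivityAt_of_contactPositivityAt hC (contactPositivityAt_zero hω hl hβ hγ hT)

/-! ## C. The seam: root positivity + peeled block law + buffer passivity ⟹ the root junction inequality -/

/-- **THE SEAM: `RP_d(C) ∧ PBL(ρ, d, L₀) ∧ BufferPassivityAt(b, L₀) ⟹ RatioJunctionRootAt ρ b (2C) L₀`.**  At one small `δ > 0` and one steady state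
(`pinnedChain_exists_isSteadyState`) the five first-order drops (two contact regions, two block interiors, the buffer) telescope to `δ`:
`δ·(E_N·(ρ/E_u + ρ/E_v − b) − 2C·√E_N − ε) ≤ δ`; let `ε → 0`, divide by `E_N > 0`. [this file] -/
theorem ratioJunctionRootAt_of_rootPeeled {ω₂ lam β γ T ρ b C : ℝ} {d L₀ : ℕ} (hω : 0 < ω₂) (hl : 0 < lam) (hβ : 0 < β)
    (hγ : 0 < γ) (hT : 0 < T) (hP : RootPositivityAt ω₂ lam β γ T C d) (hE : PeeledBlockLawAt ω₂ lam β γ T ρ d L₀)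
    (hB : BufferPassivityAt ω₂ lam β γ T b L₀) : RatioJunctionRootAt ω₂ lam β γ T ρ b (2 * C) L₀ := by
  obtain ⟨N₂, hP⟩ := hP
  obtain ⟨N₂', hE⟩ := hE
  obtain ⟨N₂'', hB⟩ := hB
  refine ⟨max (max N₂ N₂') (max N₂'' (d + 2)), fun u v hu hv => ?_⟩
  have huN : N₂ ≤ u := le_trans (le_trans (le_max_left _ _) (le_max_left _ _)) hu
  have huN' : N₂' ≤ u := le_trans (le_trans (le_max_right _ _) (le_max_left _ _)) hu
  have hvN' : N₂' ≤ v := le_trans (le_trans (le_max_right _ _) (le_max_left _ _)) hv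
  have huN'' : N₂'' ≤ u := le_trans (le_trans (le_max_left _ _) (le_max_right _ _)) hu
  have hvN'' : N₂'' ≤ v := le_trans (le_trans (le_max_left _ _) (le_max_right _ _)) hv
  have hud : d + 2 ≤ u := le_trans (le_trans (le_max_right _ _) (le_max_right _ _)) hu
  have hvd : d + 2 ≤ v := le_trans (le_trans (le_max_right _ _) (le_max_right _ _)) hv
  set EN := escapeDeficit ω₂ lam β γ T (u + L₀ + v) with hEN_def
  set Eu := escapeDeficit ω₂ lam β γ T u with hEu_def
  set Ev := escapeDeficit ω₂ lam β γ T v with hEv_def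
  have hENpos : 0 < EN := escapeDeficit_pos hω hl hβ hγ hT (by omega)
  set s := Real.sqrt EN with hs_def
  have hs : 0 < s := Real.sqrt_pos.2 hENpos
  have hsE : s * s = EN := Real.mul_self_sqrt hENpos.le
  have key : EN * (ρ * (1 / Eu + 1 / Ev) - b) - 2 * C * s ≤ 1 := by
    refine le_of_forall_pos_le_add fun ε hε => ?_
    have hε5 : 0 < ε / 5 := by positivity
    obtain ⟨δ₁, hδ₁, h1⟩ := hP (u + L₀ + v) (le_trans huN (by omega)) (by omega) (ε / 5) hε5
    obtain ⟨δ₂, hδ₂, h2⟩ := hE u v huN' hvN' (by omega) (by omega) (ε / 5) hε5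
    obtain ⟨δ₃, hδ₃, h3⟩ := hB u v huN'' hvN'' (by omega) (by omega) (ε / 5) hε5
    set δ : ℝ := min (min δ₁ δ₂) (min δ₃ T) / 2 with hδ_def
    have hm1 : min (min δ₁ δ₂) (min δ₃ T) ≤ δ₁ := (min_le_left _ _).trans (min_le_left _ _)
    have hm2 : min (min δ₁ δ₂) (min δ₃ T) ≤ δ₂ := (min_le_left _ _).trans (min_le_right _ _)
    have hm3 : min (min δ₁ δ₂) (min δ₃ T) ≤ δ₃ := (min_le_right _ _).trans (min_le_left _ _)
    have hmT : min (min δ₁ δ₂) (min δ₃ T) ≤ T := (min_le_right _ _).trans (min_le_right _ _)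
    have hmpos : 0 < min (min δ₁ δ₂) (min δ₃ T) := lt_min (lt_min hδ₁ hδ₂) (lt_min hδ₃ hT)
    have hδpos : 0 < δ := by rw [hδ_def]; linarith
    have hδlt1 : δ < δ₁ := by rw [hδ_def]; linarith
    have hδlt2 : δ < δ₂ := by rw [hδ_def]; linarith
    have hδlt3 : δ < δ₃ := by rw [hδ_def]; linarith
    have hTL : 0 < T + δ / 2 := by linarith
    have hTR : 0 < T - δ / 2 := by rw [hδ_def]; linarith
    obtain ⟨μ, hμ⟩ := pinnedChain_exists_isSteadyState hω hl hβ hγ (u + L₀ + v) hTL hTR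
    obtain ⟨hcl, hcr⟩ := h1 δ hδpos hδlt1 μ hμ
    obtain ⟨hil, hir⟩ := h2 δ hδpos hδlt2 μ hμ
    have hmid := h3 δ hδpos hδlt3 μ hμ
    have hsum : δ * (EN * (ρ * (1 / Eu + 1 / Ev) - b) - 2 * C * s - ε) ≤ δ := by
      have hadd := add_le_add (add_le_add (add_le_add (add_le_add hcl hil) hmid) hir) hcr
      have hlhs : -(δ * (C * s + ε / 5)) + δ * (EN * (ρ / Eu) - ε / 5) + -(δ * (b * EN + ε / 5))
            + δ * (EN * (ρ / Ev) - ε / 5) + -(δ * (C * s + ε / 5))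
          = δ * (EN * (ρ * (1 / Eu + 1 / Ev) - b) - 2 * C * s - ε) := by ring
      have hrhs : (T + δ / 2 - ∫ x, x.2 ⟨d, by omega⟩ ^ 2 ∂μ)
          + (∫ x, x.2 ⟨d, by omega⟩ ^ 2 ∂μ - ∫ x, x.2 ⟨u - 1, by omega⟩ ^ 2 ∂μ)
          + (∫ x, x.2 ⟨u - 1, by omega⟩ ^ 2 ∂μ - ∫ x, x.2 ⟨u + L₀, by omega⟩ ^ 2 ∂μ)
          + (∫ x, x.2 ⟨u + L₀, by omega⟩ ^ 2 ∂μ - ∫ x, x.2 ⟨u + L₀ + v - 1 - d, by omega⟩ ^ 2 ∂μ)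
          + (∫ x, x.2 ⟨u + L₀ + v - 1 - d, by omega⟩ ^ 2 ∂μ - (T - δ / 2)) = δ := by ring
      linarith
    have hdiv : EN * (ρ * (1 / Eu + 1 / Ev) - b) - 2 * C * s - ε ≤ 1 := by
      by_contra hcon
      push Not at hcon
      have : δ * 1 < δ * (EN * (ρ * (1 / Eu + 1 / Ev) - b) - 2 * C * s - ε) := mul_lt_mul_of_pos_left hcon hδpos
      linarith
    linarith
  -- divide by `E_N = s·s`: `2C/s = 2C·s/E_N`
  have hcs : 2 * C / s = 2 * C * s / EN := by
    rw [← hsE]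
    field_simp
  rw [hcs, le_div_iff₀ hENpos]
  have e2 : (ρ * (1 / Eu + 1 / Ev) - b - 2 * C * s / EN) * EN = EN * (ρ * (1 / Eu + 1 / Ev) - b) - 2 * C * s := by
    rw [sub_mul, div_mul_cancel₀ _ (ne_of_gt hENpos)]
    ring
  rw [e2]
  exact key

end EscapeGrading

end Summit.AtomisticToContinuum.FouriersLaw.Theorems.SubdiffusiveBondHeat

end
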